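import Summits.Ventures.QEC.Census.Bits
import Literature.InformationTheory.QuantumCodes.StabilizerDistance
import HarnessLib

/-!
# Brute-force certificates for general (additive) stabilizer codes, I: packed Pauli words and the replay `scan4`

Word layer and enumeration of the general-stabilizer certificate checker `Census/AdditiveCertCheck.lean`
(plan/CERT-FORMAT.md v1.2 §3S: generators and Pauli words as pairs of bitmasks `(x|z)`, bit `j` = qubit `j`, over
type-01's `ofBitPair` / `bitCount` of `Census/Bits.lean`):

* `sympParity`, `sympSynZero`, `pw`, `xorPairs`, `leaf` — symplectic parity, zero-syndrome test, packed weight, XOR of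
  selected rows, and the leaf test of the replay, with their meaning (`sympInner_ofBitPair_eq_sympParity`,
  `sympSynZero_iff`, `sympWeight_ofBitPair_eq_pw`, `leaf_cases`);
* `scan4 test L b x z` — structural I/X/Z/Y recursion over the qubit list `L` with budget `b`, and its COMPLETENESS
  `scan4_complete`: a passing scan has tested `(x ⊕ accX S, z ⊕ accZ S)` for every lettered selection `S` of at most
  `b` qubits of `L`;
* `suppSel`, `ofBitPair_acc_suppSel`, `length_suppSel`, `suppSel_sublist` — every `w ∈ Ē = 𝔽₂ⁿ × 𝔽₂ⁿ` is the word of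
  the lettered selection of its support, of length `sympWeight w`; hence a passing replay of budget `d − 1` has
  tested every Pauli word of weight `≤ d − 1`.

All elementary ("folklore") bit arithmetic; pure `List`/`Nat` structural recursion (kernel-reducible by `decide`).
-/

namespace Summit.Ventures.QEC.Census

open Matrix Literature.InformationTheory.QuantumCodes

/-! ## Word-level primitives on packed Pauli words `(x-mask, z-mask)` -/

/-- Parity of the symplectic inner product of two packed Pauli words over `n` qubits. -/
def sympParity (n : ℕ) (a b : ℕ × ℕ) : ℕ := (bitCount n (a.1 &&& b.2) + bitCount n (b.1 &&& a.2)) % 2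

/-- `sympSynZero n rows w`: `w` commutes with every row (zero syndrome). -/
def sympSynZero (n : ℕ) (rows : List (ℕ × ℕ)) (w : ℕ × ℕ) : Bool := rows.all fun r => sympParity n r w == 0

/-- The packed weight: number of qubits `< n` carrying a non-identity letter. -/
def pw (n : ℕ) (w : ℕ × ℕ) : ℕ := bitCount n (w.1 ||| w.2)

/-- XOR of the rows selected by the bits of the coefficient numeral `c` (bit `i` ↔ `rows[i]`). -/
def xorPairs : List (ℕ × ℕ) → ℕ → ℕ × ℕ
  | [], _ => (0, 0)
  | r :: rest, c =>
    if c.testBit 0 then (r.1 ^^^ (xorPairs rest (c / 2)).1, r.2 ^^^ (xorPairs rest (c / 2)).2)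
    else xorPairs rest (c / 2)

/-- The leaf test of the replay: nonzero syndrome, or the identity word, or an allow-listed word. -/
def leaf (n : ℕ) (rows : List (ℕ × ℕ)) (allow : List (ℕ × ℕ)) (x z : ℕ) : Bool :=
  !(sympSynZero n rows (x, z)) || (x == 0 && z == 0) || allow.elem (x, z)

/-- `scan4 test L b x z`: from the partial word `(x|z)`, place on at most `b` of the remaining qubits `L` one of the
letters `X`, `Z`, `Y` (skip = `I`), and require `test` at every end point. Structural on `L`. -/
def scan4 (test : ℕ → ℕ → Bool) : List ℕ → ℕ → ℕ → ℕ → Bool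
  | [], _, x, z => test x z
  | _ :: _, 0, x, z => test x z
  | j :: rest, b + 1, x, z =>
    scan4 test rest (b + 1) x z && scan4 test rest b (x ^^^ 2 ^ j) z && scan4 test rest b x (z ^^^ 2 ^ j) &&
      scan4 test rest b (x ^^^ 2 ^ j) (z ^^^ 2 ^ j)

/-! ## Soundness of the word-level primitives -/

section Words

variable (n : ℕ)

/-- The packed symplectic parity is the symplectic inner product. -/
theorem sympInner_ofBitPair_eq_sympParity (a b : ℕ × ℕ) :
    sympInner (ofBitPair n a.1 a.2) (ofBitPair n b.1 b.2) = (sympParity n a b : ZMod 2) := by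
  rw [sympInner_ofBitPair, sympParity, ZMod.natCast_mod, Nat.cast_add]

/-- `sympParity = 0 ↔` the packed words commute. -/
theorem sympParity_eq_zero_iff (a b : ℕ × ℕ) :
    sympParity n a b = 0 ↔ sympInner (ofBitPair n a.1 a.2) (ofBitPair n b.1 b.2) = 0 := by
  rw [sympInner_ofBitPair_eq_zero_iff, sympParity]

/-- `sympParity` is `0` or `1`; it is `1` iff the symplectic inner product is nonzero. -/
theorem sympInner_ne_zero_of_sympParity_eq_one {a b : ℕ × ℕ} (h : sympParity n a b = 1) :
    sympInner (ofBitPair n a.1 a.2) (ofBitPair n b.1 b.2) ≠ 0 := by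
  rw [Ne, ← sympParity_eq_zero_iff, h]; exact one_ne_zero

/-- The packed weight is the symplectic weight. -/
theorem sympWeight_ofBitPair_eq_pw (w : ℕ × ℕ) : sympWeight (ofBitPair n w.1 w.2) = pw n w :=
  sympWeight_ofBitPair n w.1 w.2

/-- `sympSynZero` means: zero syndrome against every listed row. -/
theorem sympSynZero_iff (rows : List (ℕ × ℕ)) (w : ℕ × ℕ) :
    sympSynZero n rows w = true ↔ ∀ r ∈ rows, sympInner (ofBitPair n r.1 r.2) (ofBitPair n w.1 w.2) = 0 := by
  simp only [sympSynZero, List.all_eq_true, beq_iff_eq, sympParity_eq_zero_iff]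

end Words

/-! ## Two small unpackings -/

/-- The packed identity word is the zero vector. -/
theorem ofBitPair_zero (n : ℕ) : ofBitPair n 0 0 = 0 :=
  Prod.ext (funext fun i => by simp [ofBits_apply]) (funext fun i => by simp [ofBits_apply])

/-- Unpacking the leaf test. -/
theorem leaf_cases {n : ℕ} {rows allow : List (ℕ × ℕ)} {x z : ℕ} (h : leaf n rows allow x z = true) :
    sympSynZero n rows (x, z) = false ∨ (x = 0 ∧ z = 0) ∨ (x, z) ∈ allow := by
  simp only [leaf, Bool.or_eq_true, Bool.not_eq_true', Bool.and_eq_true, beq_iff_eq] at h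
  rcases h with (h | h) | h
  · exact Or.inl h
  · exact Or.inr (Or.inl h)
  · exact Or.inr (Or.inr (List.mem_of_elem_eq_true h))

/-! ## Soundness: completeness of the replay -/

section Scan

/-- A lettered selection: qubit index with the two bits of its letter (`X = (1,0)`, `Z = (0,1)`, `Y = (1,1)`). -/
abbrev Sel : Type := List (ℕ × Bool × Bool)

/-- Accumulated `x`-word of a selection. -/
def accX : Sel → ℕ
  | [] => 0
  | (j, bx, _) :: t => (if bx then 2 ^ j else 0) ^^^ accX t

/-- Accumulated `z`-word of a selection. -/
def accZ : Sel → ℕ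
  | [] => 0
  | (j, _, bz) :: t => (if bz then 2 ^ j else 0) ^^^ accZ t

/-- With budget `0` the scan is the test at the start point. -/
theorem scan4_zero (test : ℕ → ℕ → Bool) (L : List ℕ) (x z : ℕ) (h : scan4 test L 0 x z = true) :
    test x z = true := by
  cases L with
  | nil => exact h
  | cons a L => exact h

/-- **Completeness of the 4-way enumeration**: if `scan4 test L b x z` holds then `test` holds at
`(x ⊕ accX S, z ⊕ accZ S)` for every lettered selection `S` of at most `b` qubits of `L` (in order). -/
theorem scan4_complete (test : ℕ → ℕ → Bool) :
    ∀ (L : List ℕ) (b x z : ℕ), scan4 test L b x z = true →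
      ∀ S : Sel, (S.map Prod.fst).Sublist L → S.length ≤ b →
        test (x ^^^ accX S) (z ^^^ accZ S) = true := by
  intro L
  induction L with
  | nil =>
    intro b x z h S hS _
    have : S = [] := by simpa using List.sublist_nil.mp hS
    subst this
    simpa [scan4, accX, accZ] using h
  | cons j L ih =>
    intro b x z h S hS hlen
    cases b with
    | zero =>
      have hS0 : S = [] := List.eq_nil_of_length_eq_zero (Nat.le_zero.mp hlen)
      subst hS0
      simpa [accX, accZ] using scan4_zero test _ x z h
    | succ b =>
      simp only [scan4, Bool.and_eq_true] at h
      obtain ⟨⟨⟨hI, hX⟩, hZ⟩, hY⟩ := h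
      cases S with
      | nil => simpa [accX, accZ] using ih (b + 1) x z hI [] (List.nil_sublist _) (Nat.zero_le _)
      | cons e S' =>
        obtain ⟨j', bx, bz⟩ := e
        rw [List.map_cons] at hS
        have hlen' : S'.length ≤ b := by simpa using hlen
        rcases List.sublist_cons_iff.1 hS with hskip | ⟨r, hr, hsub⟩
        · -- qubit `j` skipped
          exact ih (b + 1) x z hI ((j', bx, bz) :: S') hskip hlen
        · -- qubit `j` carries the letter `(bx, bz)`: `j' = j`
          obtain ⟨hjj, rfl⟩ := List.cons_eq_cons.1 hr
          subst hjj
          cases bx <;> cases bz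
          · -- `(false,false)`: the identity letter — same word as without it
            have := ih (b + 1) x z hI S' hsub (by omega)
            simpa [accX, accZ] using this
          · have := ih b _ _ hZ S' hsub hlen'
            simpa [accX, accZ, Nat.xor_assoc] using this
          · have := ih b _ _ hX S' hsub hlen'
            simpa [accX, accZ, Nat.xor_assoc] using this
          · have := ih b _ _ hY S' hsub hlen'
            simpa [accX, accZ, Nat.xor_assoc] using this

end Scan

/-! ## Soundness: from a vector of `Ē` to the selection of its support -/

section Support

variable (n : ℕ)

/-- The lettered support of `w ∈ Ē`: the qubits `i` with `wᵢ ≠ I`, each with its letter bits. -/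
def suppSel (w : SympVec n) : Sel :=
  ((List.finRange n).filter fun i : Fin n => decide (w.1 i ≠ 0 ∨ w.2 i ≠ 0)).map
    fun i : Fin n => (i.1, decide (w.1 i ≠ 0), decide (w.2 i ≠ 0))

/-- The support selection runs over `0 … n−1` in order. -/
theorem suppSel_sublist (w : SympVec n) : ((suppSel n w).map Prod.fst).Sublist (List.range n) := by
  have h1 : (suppSel n w).map Prod.fst =
      ((List.finRange n).filter fun i : Fin n => decide (w.1 i ≠ 0 ∨ w.2 i ≠ 0)).map Fin.val := by
    rw [suppSel, List.map_map]; rfl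
  rw [h1, ← List.map_coe_finRange_eq_range]
  exact (List.filter_sublist).map _

/-- Its length is the symplectic weight. -/
theorem length_suppSel (w : SympVec n) : (suppSel n w).length = sympWeight w := by
  rw [suppSel, List.length_map, sympWeight, ← List.toFinset_card_of_nodup ((List.nodup_finRange n).filter _),
    List.toFinset_filter, List.toFinset_finRange]
  congr 1
  ext i
  simp

/-- Bits of the accumulated `x`-word of a lettered list built from distinct qubits. -/
private theorem testBit_accX_map (f g : Fin n → Bool) (i : ℕ) :
    ∀ (T : List (Fin n)), T.Nodup →
      ((accX (T.map fun i' : Fin n => (i'.1, f i', g i'))).testBit i = true ↔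
        ∃ i' ∈ T, i'.1 = i ∧ f i' = true)
  | [], _ => by simp [accX]
  | a :: T, hT => by
    rw [List.nodup_cons] at hT
    have ih := testBit_accX_map f g i T hT.2
    rw [List.map_cons, accX, Nat.testBit_xor]
    by_cases ha : a.1 = i
    · -- no element of `T` sits at qubit `i`
      have hQ : (accX (T.map fun i' : Fin n => (i'.1, f i', g i'))).testBit i = false := by
        rw [Bool.eq_false_iff]
        intro hq
        obtain ⟨i', hi', hi'i, -⟩ := ih.1 hq
        exact hT.1 (by rwa [show i' = a from Fin.ext (hi'i.trans ha.symm)] at hi')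
      rw [hQ, Bool.xor_false]
      constructor
      · intro hP
        refine ⟨a, List.mem_cons_self, ha, ?_⟩
        cases hfa : f a
        · rw [hfa] at hP; simp at hP
        · rfl
      · rintro ⟨i', hi', hi'i, hf⟩
        rcases List.mem_cons.1 hi' with rfl | hmem
        · rw [hf, if_pos rfl, ← ha, Nat.testBit_two_pow_self]
        · have := ih.2 ⟨i', hmem, hi'i, hf⟩
          rw [hQ] at this
          exact absurd this Bool.false_ne_true
    · have hP : (if f a then 2 ^ a.1 else 0).testBit i = false := by
        cases f a
        · simp
        · rw [if_pos rfl, Nat.testBit_two_pow_of_ne ha]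
      rw [hP, Bool.false_xor, ih]
      constructor
      · rintro ⟨i', hi', h1, h2⟩
        exact ⟨i', List.mem_cons_of_mem _ hi', h1, h2⟩
      · rintro ⟨i', hi', h1, h2⟩
        rcases List.mem_cons.1 hi' with rfl | hmem
        · exact absurd h1 ha
        · exact ⟨i', hmem, h1, h2⟩

/-- The accumulated `z`-word is the accumulated `x`-word of the letter-swapped list. -/
private theorem accZ_map_eq (f g : Fin n → Bool) :
    ∀ T : List (Fin n), accZ (T.map fun i' : Fin n => (i'.1, f i', g i')) =
      accX (T.map fun i' : Fin n => (i'.1, g i', f i'))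
  | [] => rfl
  | a :: T => by rw [List.map_cons, List.map_cons, accZ, accX, accZ_map_eq f g T]

/-- **The accumulated words of the support selection of `w` give back `w`.** -/
theorem ofBitPair_acc_suppSel (w : SympVec n) : ofBitPair n (accX (suppSel n w)) (accZ (suppSel n w)) = w := by
  have h01 : ∀ x : ZMod 2, x ≠ 0 → x = 1 := by decide
  set T := (List.finRange n).filter fun i : Fin n => decide (w.1 i ≠ 0 ∨ w.2 i ≠ 0) with hT
  have hTn : T.Nodup := (List.nodup_finRange n).filter _
  have hmemT : ∀ i : Fin n, i ∈ T ↔ (w.1 i ≠ 0 ∨ w.2 i ≠ 0) := fun i => by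
    simp [hT, List.mem_filter, List.mem_finRange]
  have hX := testBit_accX_map n (fun i => decide (w.1 i ≠ 0)) (fun i => decide (w.2 i ≠ 0))
  have hZ := testBit_accX_map n (fun i => decide (w.2 i ≠ 0)) (fun i => decide (w.1 i ≠ 0))
  have hSX : accX (suppSel n w) = accX (T.map fun i' : Fin n => (i'.1, decide (w.1 i' ≠ 0), decide (w.2 i' ≠ 0))) :=
    rfl
  have hSZ : accZ (suppSel n w) = accX (T.map fun i' : Fin n => (i'.1, decide (w.2 i' ≠ 0), decide (w.1 i' ≠ 0))) :=
    accZ_map_eq n _ _ T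
  refine Prod.ext (funext fun i => ?_) (funext fun i => ?_)
  · rw [ofBitPair_fst, ofBits_apply, hSX]
    by_cases h : w.1 i ≠ 0
    · have hb := (hX i T hTn).2 ⟨i, (hmemT i).2 (Or.inl h), rfl, decide_eq_true h⟩
      rw [hb, if_pos rfl, h01 _ h]
    · have hb : (accX (T.map fun i' : Fin n => (i'.1, decide (w.1 i' ≠ 0), decide (w.2 i' ≠ 0)))).testBit i =
          false := by
        rw [Bool.eq_false_iff]
        intro hq
        obtain ⟨i', -, hi'i, hf⟩ := (hX i T hTn).1 hq
        rw [show i' = i from Fin.ext hi'i, decide_eq_true_eq] at hf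
        exact h hf
      rw [hb]
      simpa using (not_not.mp h).symm
  · rw [ofBitPair_snd, ofBits_apply, hSZ]
    by_cases h : w.2 i ≠ 0
    · have hb := (hZ i T hTn).2 ⟨i, (hmemT i).2 (Or.inr h), rfl, decide_eq_true h⟩
      rw [hb, if_pos rfl, h01 _ h]
    · have hb : (accX (T.map fun i' : Fin n => (i'.1, decide (w.2 i' ≠ 0), decide (w.1 i' ≠ 0)))).testBit i =
          false := by
        rw [Bool.eq_false_iff]
        intro hq
        obtain ⟨i', -, hi'i, hf⟩ := (hZ i T hTn).1 hq
        rw [show i' = i from Fin.ext hi'i, decide_eq_true_eq] at hf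
        exact h hf
      rw [hb]
      simpa using (not_not.mp h).symm

end Support

end Summit.Ventures.QEC.Census
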